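import Summits.Langlands.Langlands.Theses.QuarterDeficit1951
import Literature.NumberTheory.GaloisRepresentations.GaloisRepUnramifiedProofs
import Literature.NumberTheory.GaloisRepresentations.TateUnramifiedLiftingHolds
import Literature.NumberTheory.GaloisRepresentations.DirichletCharacterOfGaloisCharacter
import Literature.FieldTheory.AlgClosed.PadicAlgClEquivComplex
import Literature.NumberTheory.Automorphic.BCDTTheoremBWildAtThreeDet
import Mathlib.RingTheory.RootsOfUnity.AlgebraicallyClosed

/-!
# Route `QuarterDeficit1951` (Langlands) — crux `IcosahedralSupply`: the icosahedral embedding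

Stub `stub_icosahedralEmbedding` of line `Sketch`: for every algebraically closed field `k` of
characteristic `0` there is an injective homomorphism `A₅ ↪ PGL₂(k)`.

Construction (presentation-free; the certificate is checked by the kernel, inside the proof):
* a computable model of `ℤ[ζ₅]` (quadruples `(a, b, c, d) = a + bζ + cζ² + dζ³`,
  `ζ⁴ = -1 - ζ - ζ² - ζ³`) and of `M₂(ℤ[ζ₅])` (quadruples of entries `(e₀₀, e₀₁, e₁₀, e₁₁)`);
* `tab`, the explicit list of the `60` icosahedral matrices in `M₂(ℤ[ζ₅])` (the group
  `2I/±1 ≅ A₅`, Klein's generators `S = diag(ζ³, ζ²)` and `√5·T`, `√5 = ζ + ζ⁴ - ζ² - ζ³`), matched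
  with `A₅` along `a = (1 2)(3 4) ↦ √5·T`, `(0 1 2 3 4) ↦ S` and indexed by `(g 0, g 1, g 2)`; the
  table was produced offline and is CERTIFIED here by `decide +kernel`: for the generators
  `x ∈ {a, b}` (`b = (0 2 4)`) and all `h ∈ A₅` the matrix `M_x · M_h · adj M_{xh}` is scalar, every
  determinant is `1` or `5`, `M_1 = 1`, the `5`-cycle `i ↦ i + 1` goes to `diag(ζ³, ζ²)`, and every
  `g ∈ A₅` is an explicit word in `a, b` (so multiplicativity propagates from the generators);
* evaluating at a primitive fifth root of unity `ζ : k` gives `ψ : A₅ →* PGL₂(k)`, non-trivial on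
  the `5`-cycle (`ζ³ ≠ ζ²`), hence injective since `A₅` is simple.

References: F. Klein, *Vorlesungen über das Ikosaeder* (1884), I §2.8; J-P. Serre, Modular forms of
weight one and Galois representations (Durham 1977), §8.1.
-/

set_option linter.dupNamespace false

noncomputable section

open scoped NumberField MatrixGroups
open Field IsDedekindDomain Polynomial
open Literature.NumberTheory.GaloisRepresentations Literature.NumberTheory.PAdicHodge

namespace Summit.Langlands.Langlands.Theorems.QuarterDeficit1951

/-- Two invertible `2 × 2` matrices `P`, `R` with `P · adj R` scalar have the same image in
`PGL₂(k)`. [folklore] -/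
private theorem mk_eq_mk_of_mul_adjugate {k : Type} [Field k] {P R : GL (Fin 2) k} {c : k}
    (h : (P : Matrix (Fin 2) (Fin 2) k) * (R : Matrix (Fin 2) (Fin 2) k).adjugate =
      c • (1 : Matrix (Fin 2) (Fin 2) k)) :
    Matrix.ProjGenLinGroup.mk R = Matrix.ProjGenLinGroup.mk P := by
  have hR : (R : Matrix (Fin 2) (Fin 2) k).det ≠ 0 := Matrix.GeneralLinearGroup.det_ne_zero R
  have hP : (P : Matrix (Fin 2) (Fin 2) k).det ≠ 0 := Matrix.GeneralLinearGroup.det_ne_zero P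
  have h1 : (R : Matrix (Fin 2) (Fin 2) k).det • (P : Matrix (Fin 2) (Fin 2) k) =
      c • (R : Matrix (Fin 2) (Fin 2) k) := by
    simpa only [Matrix.mul_assoc, Matrix.adjugate_mul, Matrix.mul_smul, Matrix.mul_one,
      Matrix.smul_mul, Matrix.one_mul] using congrArg (· * (R : Matrix (Fin 2) (Fin 2) k)) h
  have hc : c ≠ 0 := by
    rintro rfl
    rw [zero_smul, smul_eq_zero] at h1
    rcases h1 with h1 | h1
    · exact hR h1
    · exact hP (by rw [h1, Matrix.det_zero])
  rw [Matrix.ProjGenLinGroup.mk_eq_mk_iff]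
  refine ⟨Units.mk0 _ (div_ne_zero hc hR), Units.ext ?_⟩
  rw [Units.val_mul, Matrix.GeneralLinearGroup.coe_scalar, Units.val_mk0, Matrix.scalar_apply,
    ← Matrix.smul_one_eq_diagonal, Matrix.mul_smul, Matrix.mul_one, div_eq_inv_mul, ← smul_smul,
    ← h1, smul_smul, inv_mul_cancel₀ hR, one_smul]

/-- **Stub (icosahedral embedding).** For every algebraically closed field `k` of characteristic
`0` there is an injective homomorphism `A₅ ↪ PGL₂(k)` (the icosahedral subgroup; explicit matrices
over `ℚ(ζ₅) ⊆ k`). [cite: SerreDurham1977, §8.1] -/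
theorem stub_icosahedralEmbedding (k : Type) [Field k] [IsAlgClosed k] [CharZero k] :
    ∃ ψ : alternatingGroup (Fin 5) →* PGL(2, k), Function.Injective ψ := by
  /- ### 1. The computable model of `ℤ[ζ₅]` and of `M₂(ℤ[ζ₅])` -/
  let zadd : ℤ × ℤ × ℤ × ℤ → ℤ × ℤ × ℤ × ℤ → ℤ × ℤ × ℤ × ℤ :=
    fun ⟨a, b, c, d⟩ ⟨a', b', c', d'⟩ => (a + a', b + b', c + c', d + d')
  let zneg : ℤ × ℤ × ℤ × ℤ → ℤ × ℤ × ℤ × ℤ := fun ⟨a, b, c, d⟩ => (-a, -b, -c, -d)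
  -- multiplication, reduced with `ζ⁴ = -1 - ζ - ζ² - ζ³`, `ζ⁵ = 1`, `ζ⁶ = ζ`
  let zmul : ℤ × ℤ × ℤ × ℤ → ℤ × ℤ × ℤ × ℤ → ℤ × ℤ × ℤ × ℤ :=
    fun ⟨a, b, c, d⟩ ⟨a', b', c', d'⟩ =>
      (a * a' - (b * d' + c * c' + d * b') + (c * d' + d * c'),
        a * b' + b * a' - (b * d' + c * c' + d * b') + d * d',
        a * c' + b * b' + c * a' - (b * d' + c * c' + d * b'),
        a * d' + b * c' + c * b' + d * a' - (b * d' + c * c' + d * b'))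
  let Q : Type := (ℤ × ℤ × ℤ × ℤ) × (ℤ × ℤ × ℤ × ℤ) × (ℤ × ℤ × ℤ × ℤ) × (ℤ × ℤ × ℤ × ℤ)
  let qmul : Q → Q → Q := fun ⟨m₀₀, m₀₁, m₁₀, m₁₁⟩ ⟨n₀₀, n₀₁, n₁₀, n₁₁⟩ =>
    (zadd (zmul m₀₀ n₀₀) (zmul m₀₁ n₁₀), zadd (zmul m₀₀ n₀₁) (zmul m₀₁ n₁₁),
      zadd (zmul m₁₀ n₀₀) (zmul m₁₁ n₁₀), zadd (zmul m₁₀ n₀₁) (zmul m₁₁ n₁₁))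
  let qadj : Q → Q := fun ⟨m₀₀, m₀₁, m₁₀, m₁₁⟩ => (m₁₁, zneg m₀₁, zneg m₁₀, m₀₀)
  let qdet : Q → ℤ × ℤ × ℤ × ℤ := fun ⟨m₀₀, m₀₁, m₁₀, m₁₁⟩ =>
    zadd (zmul m₀₀ m₁₁) (zneg (zmul m₀₁ m₁₀))
  let isScal : Q → Bool := fun ⟨m₀₀, m₀₁, m₁₀, m₁₁⟩ =>
    m₀₁ = (0, 0, 0, 0) && m₁₀ = (0, 0, 0, 0) && m₀₀ = m₁₁
  /- ### 2. The icosahedral table (row-major, each entry `a + bζ + cζ² + dζ³` as `a b c d`),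
    indexed by `idx g`, an injective function of `(g 0, g 1, g 2)`. -/
  let q : ℤ → ℤ → ℤ → ℤ → ℤ → ℤ → ℤ → ℤ → ℤ → ℤ → ℤ → ℤ → ℤ → ℤ → ℤ → ℤ → Q :=
    fun a₁ b₁ c₁ d₁ a₂ b₂ c₂ d₂ a₃ b₃ c₃ d₃ a₄ b₄ c₄ d₄ =>
      ((a₁, b₁, c₁, d₁), (a₂, b₂, c₂, d₂), (a₃, b₃, c₃, d₃), (a₄, b₄, c₄, d₄))
  let tab := [
    q 1 0 0 0 0 0 0 0 0 0 0 0 1 0 0 0,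
    q 0 (-1) 1 0 1 1 2 1 0 1 0 (-1) 1 1 1 2,
    q (-1) (-1) (-1) (-2) 1 1 2 1 0 1 0 (-1) 0 1 (-1) 0,
    q (-1) (-2) (-1) (-1) 0 0 1 (-1) 0 0 1 (-1) 1 2 1 1,
    q 0 (-1) 1 0 0 1 0 (-1) 1 1 2 1 1 1 1 2,
    q (-1) (-1) (-2) (-1) 0 (-1) 1 0 (-1) (-1) (-1) (-2) 0 1 0 (-1),
    q (-1) (-1) (-1) (-2) 0 1 0 (-1) 1 1 2 1 0 1 (-1) 0,
    q (-1) (-1) (-2) (-1) (-1) (-1) (-1) (-2) 0 (-1) 1 0 0 1 0 (-1),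
    q 0 0 (-1) 1 (-1) (-2) (-1) (-1) (-1) (-2) (-1) (-1) 0 0 1 (-1),
    q 0 (-1) 0 1 0 (-1) 1 0 (-1) (-1) (-1) (-2) 1 1 2 1,
    q 0 (-1) 0 1 (-1) (-1) (-1) (-2) 0 (-1) 1 0 1 1 2 1,
    q 0 0 0 0 (-1) 0 0 0 1 0 0 0 0 0 0 0,
    q (-1) (-2) (-1) (-1) (-2) (-1) (-1) (-1) 1 (-1) 0 0 1 2 1 1,
    q (-1) (-2) (-1) (-1) 0 1 (-1) 0 1 1 1 2 1 2 1 1,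
    q 0 0 0 0 0 0 0 (-1) 0 0 1 0 0 0 0 0,
    q 0 (-1) 1 0 1 0 (-1) 0 (-1) 0 0 1 1 1 1 2,
    q 0 0 0 1 0 0 0 0 0 0 0 0 0 0 1 0,
    q (-2) (-1) (-1) (-1) (-1) 0 1 0 1 0 0 (-1) (-1) 1 0 0,
    q (-1) 0 1 0 2 1 1 1 (-1) 1 0 0 (-1) 0 0 1,
    q (-1) (-1) (-2) (-1) (-1) 1 0 0 2 1 1 1 0 1 0 (-1),
    q (-2) (-1) (-1) (-1) 1 2 1 1 1 2 1 1 (-1) 1 0 0,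
    q (-1) 1 0 0 1 1 2 1 0 1 0 (-1) (-2) (-1) (-1) (-1),
    q 0 (-1) 1 0 (-1) (-2) (-1) (-1) (-1) (-2) (-1) (-1) 1 1 1 2,
    q (-1) 0 1 0 0 (-1) 1 0 (-1) (-1) (-1) (-2) (-1) 0 0 1,
    q (-1) (-1) (-1) (-2) 1 0 (-1) 0 (-1) 0 0 1 0 1 (-1) 0,
    q (-2) (-1) (-1) (-1) (-1) (-1) (-2) (-1) 0 (-1) 0 1 (-1) 1 0 0,
    q (-1) 0 0 1 (-2) (-1) (-1) (-1) 1 (-1) 0 0 (-1) 0 1 0,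
    q 0 0 0 0 0 (-1) 0 0 (-1) (-1) (-1) (-1) 0 0 0 0,
    q (-1) (-1) (-2) (-1) 0 0 (-1) 1 0 0 (-1) 1 0 1 0 (-1),
    q (-1) (-1) (-2) (-1) 2 1 1 1 (-1) 1 0 0 0 1 0 (-1),
    q 0 0 (-1) 1 (-1) 0 0 1 1 0 (-1) 0 0 0 1 (-1),
    q (-2) (-1) (-1) (-1) 1 0 0 (-1) (-1) 0 1 0 (-1) 1 0 0,
    q 0 1 0 0 0 0 0 0 0 0 0 0 (-1) (-1) (-1) (-1),
    q 0 0 (-1) 1 1 1 2 1 0 1 0 (-1) 0 0 1 (-1),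
    q (-1) 0 0 1 0 0 1 (-1) 0 0 1 (-1) (-1) 0 1 0,
    q (-1) 0 1 0 (-1) (-1) (-1) (-2) 0 (-1) 1 0 (-1) 0 0 1,
    q (-1) 1 0 0 1 0 (-1) 0 (-1) 0 0 1 (-2) (-1) (-1) (-1),
    q 0 (-1) 0 1 (-1) 1 0 0 2 1 1 1 1 1 2 1,
    q (-1) 0 0 1 0 1 (-1) 0 1 1 1 2 (-1) 0 1 0,
    q 0 (-1) 0 1 0 0 (-1) 1 0 0 (-1) 1 1 1 2 1,
    q 0 (-1) 1 0 (-1) 0 0 1 1 0 (-1) 0 1 1 1 2,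
    q 0 0 (-1) 1 1 0 (-1) 0 (-1) 0 0 1 0 0 1 (-1),
    q (-1) 0 1 0 0 0 (-1) 1 0 0 (-1) 1 (-1) 0 0 1,
    q 0 0 0 0 (-1) (-1) (-1) (-1) 0 (-1) 0 0 0 0 0 0,
    q (-1) 0 1 0 (-1) 1 0 0 2 1 1 1 (-1) 0 0 1,
    q (-1) (-1) (-1) (-1) 0 0 0 0 0 0 0 0 0 1 0 0,
    q (-1) 1 0 0 0 1 0 (-1) 1 1 2 1 (-2) (-1) (-1) (-1),
    q 0 0 (-1) 1 0 1 0 (-1) 1 1 2 1 0 0 1 (-1),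
    q 0 0 1 0 0 0 0 0 0 0 0 0 0 0 0 1,
    q (-1) (-1) (-1) (-2) (-1) (-2) (-1) (-1) (-1) (-2) (-1) (-1) 0 1 (-1) 0,
    q (-1) 1 0 0 (-1) (-2) (-1) (-1) (-1) (-2) (-1) (-1) (-2) (-1) (-1) (-1),
    q 0 (-1) 0 1 2 1 1 1 (-1) 1 0 0 1 1 2 1,
    q (-1) (-1) (-1) (-2) (-1) 0 0 1 1 0 (-1) 0 0 1 (-1) 0,
    q (-1) (-2) (-1) (-1) 1 1 1 2 0 1 (-1) 0 1 2 1 1,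
    q (-1) 1 0 0 (-1) 0 0 1 1 0 (-1) 0 (-2) (-1) (-1) (-1),
    q (-1) (-2) (-1) (-1) 1 (-1) 0 0 (-2) (-1) (-1) (-1) 1 2 1 1,
    q (-2) (-1) (-1) (-1) 0 (-1) 0 1 (-1) (-1) (-2) (-1) (-1) 1 0 0,
    q (-1) 0 0 1 1 1 1 2 0 1 (-1) 0 (-1) 0 1 0,
    q (-1) 0 0 1 1 (-1) 0 0 (-2) (-1) (-1) (-1) (-1) 0 1 0,
    q 0 0 0 0 0 0 (-1) 0 0 0 0 1 0 0 0 0]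
  let idx : alternatingGroup (Fin 5) → ℕ := fun g =>
    let i := (g : Equiv.Perm (Fin 5)) 0
    let j := (g : Equiv.Perm (Fin 5)) 1
    let l := (g : Equiv.Perm (Fin 5)) 2
    12 * i.val + 3 * (j.val - if i < j then 1 else 0) +
      (l.val - (if i < l then 1 else 0) - if j < l then 1 else 0)
  let M : alternatingGroup (Fin 5) → Q := fun g =>
    tab.getD (idx g) (q 0 0 0 0 0 0 0 0 0 0 0 0 0 0 0 0)
  -- generators `a = (1 2)(3 4)`, `b = (0 2 4)`, and the `5`-cycle `g₀ : i ↦ i + 1`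
  let a : alternatingGroup (Fin 5) :=
    ⟨Equiv.swap 1 2 * Equiv.swap 3 4, Equiv.Perm.mem_alternatingGroup.mpr (by decide)⟩
  let b : alternatingGroup (Fin 5) :=
    ⟨Equiv.swap 0 2 * Equiv.swap 2 4, Equiv.Perm.mem_alternatingGroup.mpr (by decide)⟩
  let g₀ : alternatingGroup (Fin 5) := ⟨Equiv.swap 0 1 * Equiv.swap 1 2 * Equiv.swap 2 3 *
    Equiv.swap 3 4, Equiv.Perm.mem_alternatingGroup.mpr (by decide)⟩
  -- words: `g = (step^[13] (w, 1)).2`, reading the binary digits of `w` below the leading `1`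
  let step : ℕ × alternatingGroup (Fin 5) → ℕ × alternatingGroup (Fin 5) := fun p =>
    (p.1 / 2, if p.1 ≤ 1 then p.2 else (if p.1 % 2 = 0 then a else b) * p.2)
  let words : List ℕ := [1, 214, 347, 2, 219, 342, 107, 117, 5549, 181, 171, 3501, 693, 29, 875,
    1371, 5, 726, 58, 10, 26, 1750, 363, 13, 437, 1387, 45, 859, 470, 3, 2774, 235, 21, 90, 6, 42,
    346, 22, 59, 173, 429, 941, 11, 858, 54, 85, 1882, 27, 14, 218, 91, 7, 1370, 86, 109, 685, 1453,
    53, 43, 2906]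
  /- ### 3. The certificate (kernel computation) -/
  have hcert : ∀ h : alternatingGroup (Fin 5),
      isScal (qmul (qmul (M a) (M h)) (qadj (M (a * h)))) = true ∧
        isScal (qmul (qmul (M b) (M h)) (qadj (M (b * h)))) = true := by
    decide +kernel
  have hdets : ∀ g : alternatingGroup (Fin 5),
      qdet (M g) = (1, 0, 0, 0) ∨ qdet (M g) = (5, 0, 0, 0) := by
    decide +kernel
  have hwords : ∀ g : alternatingGroup (Fin 5), (step^[13] (words.getD (idx g) 0, 1)).2 = g := by
    decide +kernel
  have hM1 : M 1 = ((1, 0, 0, 0), (0, 0, 0, 0), (0, 0, 0, 0), (1, 0, 0, 0)) := by decide +kernel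
  have hMg₀ : M g₀ = ((0, 0, 0, 1), (0, 0, 0, 0), (0, 0, 0, 0), (0, 0, 1, 0)) := by decide +kernel
  /- ### 4. Evaluation at a primitive fifth root of unity `ζ : k` -/
  obtain ⟨ζ, hζ⟩ : ∃ ζ : k, IsPrimitiveRoot ζ 5 := HasEnoughRootsOfUnity.exists_primitiveRoot k 5
  have hΦ : 1 + ζ + ζ ^ 2 + ζ ^ 3 + ζ ^ 4 = 0 := by
    simpa [Finset.sum_range_succ] using hζ.geom_sum_eq_zero (by norm_num : 1 < 5)
  have h5 : (5 : k) ≠ 0 := by norm_num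
  let ev : ℤ × ℤ × ℤ × ℤ → k := fun ⟨a, b, c, d⟩ => a + b * ζ + c * ζ ^ 2 + d * ζ ^ 3
  have ev_add : ∀ x y, ev (zadd x y) = ev x + ev y := by
    rintro ⟨a, b, c, d⟩ ⟨a', b', c', d'⟩; simp only [ev, zadd]; push_cast; ring
  have ev_neg : ∀ x, ev (zneg x) = -ev x := by
    rintro ⟨a, b, c, d⟩; simp only [ev, zneg]; push_cast; ring
  have ev_mul : ∀ x y, ev (zmul x y) = ev x * ev y := by
    rintro ⟨a, b, c, d⟩ ⟨a', b', c', d'⟩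
    simp only [ev, zmul]
    push_cast
    linear_combination (-((b * d' + c * c' + d * b' : k) + (c * d' + d * c' : k) * (ζ - 1) +
      (d * d' : k) * ζ * (ζ - 1))) * hΦ
  let toMat : Q → Matrix (Fin 2) (Fin 2) k := fun ⟨m₀₀, m₀₁, m₁₀, m₁₁⟩ =>
    !![ev m₀₀, ev m₀₁; ev m₁₀, ev m₁₁]
  have toMat_mul : ∀ P N, toMat (qmul P N) = toMat P * toMat N := by
    rintro ⟨m₀₀, m₀₁, m₁₀, m₁₁⟩ ⟨n₀₀, n₀₁, n₁₀, n₁₁⟩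
    simp only [toMat, qmul, Matrix.mul_fin_two, ev_add, ev_mul]
  have toMat_adj : ∀ N, toMat (qadj N) = (toMat N).adjugate := by
    rintro ⟨n₀₀, n₀₁, n₁₀, n₁₁⟩; simp only [toMat, qadj, Matrix.adjugate_fin_two_of, ev_neg]
  have det_toMat : ∀ N, (toMat N).det = ev (qdet N) := by
    rintro ⟨n₀₀, n₀₁, n₁₀, n₁₁⟩
    simp only [toMat, qdet, Matrix.det_fin_two_of, ev_add, ev_neg, ev_mul]; ring
  have toMat_scalar : ∀ N, isScal N = true → toMat N = ev N.1 • (1 : Matrix (Fin 2) (Fin 2) k) := by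
    rintro ⟨n₀₀, n₀₁, n₁₀, n₁₁⟩ h
    simp only [isScal, Bool.and_eq_true, decide_eq_true_eq] at h
    obtain ⟨⟨h01, h10⟩, h00⟩ := h
    rw [Matrix.smul_one_eq_diagonal]
    ext i j
    fin_cases i <;> fin_cases j <;> simp [toMat, h01, h10, h00, ev]
  /- ### 5. The matrices in `GL₂(k)` and the map to `PGL₂(k)` -/
  have hdet : ∀ g, (toMat (M g)).det ≠ 0 := by
    intro g
    rw [det_toMat (M g)]
    rcases hdets g with h | h <;> rw [h] <;> simp [ev, h5]
  let G : alternatingGroup (Fin 5) → GL (Fin 2) k := fun g =>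
    Matrix.GeneralLinearGroup.mkOfDetNeZero _ (hdet g)
  have hG : ∀ g, ((G g : GL (Fin 2) k) : Matrix (Fin 2) (Fin 2) k) = toMat (M g) := fun g => rfl
  let φ : alternatingGroup (Fin 5) → PGL(2, k) := fun g => Matrix.ProjGenLinGroup.mk (G g)
  -- multiplicativity at a pair `(x, h)` from the scalar test
  have hgen : ∀ x h, isScal (qmul (qmul (M x) (M h)) (qadj (M (x * h)))) = true →
      φ (x * h) = φ x * φ h := by
    intro x h hc
    have hs := toMat_scalar (qmul (qmul (M x) (M h)) (qadj (M (x * h)))) hc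
    simp only [toMat_mul, toMat_adj] at hs
    show Matrix.ProjGenLinGroup.mk (G (x * h)) =
      Matrix.ProjGenLinGroup.mk (G x) * Matrix.ProjGenLinGroup.mk (G h)
    rw [← map_mul]
    refine mk_eq_mk_of_mul_adjugate (c := ev (qmul (qmul (M x) (M h)) (qadj (M (x * h)))).1) ?_
    rw [Units.val_mul, hG x, hG h, hG (x * h)]
    exact hs
  have hma : ∀ h, φ (a * h) = φ a * φ h := fun h => hgen a h (hcert h).1
  have hmb : ∀ h, φ (b * h) = φ b * φ h := fun h => hgen b h (hcert h).2
  -- `φ 1 = 1`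
  have hφ1 : φ 1 = 1 := by
    show Matrix.ProjGenLinGroup.mk (G 1) = 1
    have : G 1 = 1 := Units.ext (by
      rw [hG 1, hM1, Units.val_one, Matrix.one_fin_two]; simp [toMat, ev])
    rw [this, map_one]
  -- multiplicativity propagates along words in `a`, `b`
  have hiter : ∀ (t : ℕ) (p : ℕ × alternatingGroup (Fin 5)), (∀ h, φ (p.2 * h) = φ p.2 * φ h) →
      ∀ h, φ ((step^[t] p).2 * h) = φ (step^[t] p).2 * φ h := by
    intro t
    induction t with
    | zero => intro p hp; simpa using hp
    | succ t ih =>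
      intro p hp
      rw [Function.iterate_succ_apply]
      refine ih _ fun h => ?_
      simp only [step]
      split_ifs
      · exact hp h
      · rw [mul_assoc, hma (p.2 * h), hp h, hma p.2, mul_assoc]
      · rw [mul_assoc, hmb (p.2 * h), hp h, hmb p.2, mul_assoc]
  have hmul : ∀ g h, φ (g * h) = φ g * φ h := by
    intro g
    have := hiter 13 (words.getD (idx g) 0, 1) fun h => by
      show φ (1 * h) = φ 1 * φ h
      rw [one_mul, hφ1, one_mul]
    rwa [hwords g] at this
  /- ### 6. The homomorphism and its injectivity (`A₅` is simple and `φ g₀ ≠ 1`) -/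
  refine ⟨MonoidHom.mk' φ hmul, ?_⟩
  haveI : IsSimpleGroup (alternatingGroup (Fin 5)) := alternatingGroup.isSimpleGroup (by simp)
  rcases (MonoidHom.mk' φ hmul).normal_ker.eq_bot_or_eq_top with hbot | htop
  · exact (MonoidHom.ker_eq_bot_iff _).mp hbot
  exfalso
  have hg : φ g₀ = 1 := by
    have hmem : g₀ ∈ (MonoidHom.mk' φ hmul).ker := htop ▸ Subgroup.mem_top g₀
    rwa [MonoidHom.mem_ker, MonoidHom.mk'_apply] at hmem
  change Matrix.ProjGenLinGroup.mk (G g₀) = 1 at hg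
  rw [← Matrix.ProjGenLinGroup.mk_one, Matrix.ProjGenLinGroup.mk_eq_mk_iff] at hg
  obtain ⟨u, hu⟩ := hg
  have hu' := congrArg (fun x : GL (Fin 2) k => (x : Matrix (Fin 2) (Fin 2) k)) hu
  simp only [Units.val_mul, hG, hMg₀, Matrix.GeneralLinearGroup.coe_scalar, Matrix.scalar_apply,
    ← Matrix.smul_one_eq_diagonal, Matrix.mul_smul, Matrix.mul_one, Units.val_one] at hu'
  have e00 : (u : k) * ζ ^ 3 = 1 := by simpa [toMat, ev] using congrFun (congrFun hu' 0) 0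
  have e11 : (u : k) * ζ ^ 2 = 1 := by simpa [toMat, ev] using congrFun (congrFun hu' 1) 1
  have key : (u : k) * ζ ^ 2 * (ζ - 1) = 0 := by linear_combination e00 - e11
  rcases mul_eq_zero.mp key with h | h
  · rcases mul_eq_zero.mp h with h | h
    · exact u.ne_zero h
    · exact hζ.ne_zero (by norm_num) ((pow_eq_zero_iff two_ne_zero).mp h)
  · exact hζ.ne_one (by norm_num) (sub_eq_zero.mp h)

end Summit.Langlands.Langlands.Theorems.QuarterDeficit1951

end
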